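import Summits.AtomisticToContinuum.BoseEinsteinCondensation.Theorems.BECStronglyRayleighLatticeToPeriodicBridgeMuffinTinDefs
import Summits.AtomisticToContinuum.BoseEinsteinCondensation.Theorems.BECStronglyRayleighLatticeCoherenceAssemblyGroundSpace
import Summits.AtomisticToContinuum.BoseEinsteinCondensation.Theorems.BECStronglyRayleighLatticeCoherenceAssemblyLowerNorm
import HarnessLib

/-!
# Lattice readout (stub `stub_latticeReadout` of line `muffin-tin-reward-supermodularity`)

Route `BECStronglyRayleigh`, crux `LatticeToPeriodicBridge` (stmt-AtomisticToContinuum-9674),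
line `muffin-tin-reward-supermodularity`, registered stub S3 `Sig.stub_latticeReadout` of the line's
`Defs` module (`…MuffinTinDefs`), proved here as `stub_latticeReadout` (exact signature, by name).

**Statement** (`LatticeReadout`). Given `SectorGroundStatePerron` (stmt-9677) and
`PenaltySelectsSector` (stmt-9678): for `M ≥ 2` and `1 ≤ N ≤ M³` there is a normalised sector-`N`
ground vector `ψ₁` of `xyTorus 3 M 1` with `latticeBracket M N ≤ cohSum ψ₁ N` (in fact equality).

**Proof.** `LatticeCoherence.groundState_penalised` gives the Perron vector `ψ` of the sector
`S³_tot = N - M³/2`, spanning the ground space of the penalised Hamiltonian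
`xyTorus 3 M 1 + 4M³(S³_tot + M³/2 - N)²`, whose tracial ground-state functional is the vector state
`O ↦ ⟨ψ, Oψ⟩/⟨ψ, ψ⟩`; normalise `ψ₁ = c • ψ` (`EigenvalueContinuation.exists_normalize`), so the
functional is `O ↦ ⟨ψ₁, Oψ₁⟩` (scale invariance of the Rayleigh quotient). On the sector,
`⟨ψ₁, ((Ŝˣ)² + (Ŝʸ)²) ψ₁⟩ + (N - M³/2) = ‖Ŝ⁻_tot ψ₁‖²` (`LatticeCoherence.re_inner_planar_add`), and
`‖Ŝ⁻_tot ψ₁‖² = cohSum ψ₁ N` (`Readout.re_norm_lower_eq_cohSum`): the coefficient of `Ŝ⁻_tot ψ₁` at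
the occupation indicator `1_T` is `Σ_{x ∉ T} ψ₁(1_{T ∪ {x}})` (`LatticeCoherence.lower_mulVec_apply`,
`LatticeCoherence.update_ind_zero`), and only `|T| = N - 1` contributes since the occupation
amplitudes of a sector vector live on `N`-sets (`LatticeCoherence.apply_ind_eq_zero_of_card_ne`).

References: LSSY 2005 (E. H. Lieb, R. Seiringer, J. P. Solovej, J. Yngvason, *The Mathematics of the
Bose Gas and its Condensation*), App. D; H. Tasaki, *Physics and Mathematics of Quantum Many-Body
Systems* (2020), §2.1 (spin-`½` ladder bookkeeping).
-/

noncomputable section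

namespace Summit.AtomisticToContinuum.BoseEinsteinCondensation.Cruxes.LatticeToPeriodicBridge.MuffinTinRewardSupermodularity

open scoped BigOperators Matrix ComplexOrder
open Literature.MathematicalPhysics.QuantumLattice Matrix Finset Complex
open Literature.Probability.LatticeModels (TorusSite)
open Summit.AtomisticToContinuum.BoseEinsteinCondensation.Theses
open Summit.AtomisticToContinuum.BoseEinsteinCondensation.Theses.BECStronglyRayleigh
open Summit.AtomisticToContinuum.BoseEinsteinCondensation.Theorems

namespace Readout

variable {M : ℕ} [NeZero M]

/-- The coefficient of `Ŝ⁻_tot ψ` at the occupation indicator `1_T` is the insertion sum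
`Σ_{x ∉ T} ψ(1_{T ∪ {x}})` (spin-`½` matrix elements of `S⁻_x` are `1`). [folklore] -/
theorem lower_mulVec_occInd (ψ : TensorIndex (TorusSite 3 M) 2 → ℂ) (T : Finset (TorusSite 3 M)) :
    ((totalSpin 1 0 - I • totalSpin 1 1 : Op (TorusSite 3 M) 2) *ᵥ ψ)
        (fun x => if x ∈ T then 0 else 1) =
      ∑ x ∈ Finset.univ \ T, ψ (occInd (insert x T)) := by
  rw [LatticeCoherence.lower_mulVec_apply, Finset.sdiff_eq_filter, Finset.sum_filter]
  refine Finset.sum_congr rfl fun y _ => ?_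
  by_cases hy : y ∈ T
  · simp [hy]
  · rw [if_pos (by simp [hy]), if_pos hy, LatticeCoherence.update_ind_zero]
    rfl

/-- **`‖Ŝ⁻_tot ψ‖² = cohSum ψ N` on the sector `S³_tot = N - M³/2`** of spin `½` on the torus
`(ℤ/M)³`: reindex configurations by occupied sets, read the coefficients of `Ŝ⁻_tot ψ` as insertion
sums, and drop the sets `T` with `|T| ≠ N - 1`, on which every inserted amplitude vanishes because the
occupation amplitudes of a sector vector live on `N`-sets. [folklore] -/
theorem re_norm_lower_eq_cohSum (N : ℕ) (ψ : TensorIndex (TorusSite 3 M) 2 → ℂ)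
    (hψ : ψ ∈ spinZSector 1 ((N : ℝ) - (M : ℝ) ^ 3 / 2)) :
    (star ((totalSpin 1 0 - I • totalSpin 1 1 : Op (TorusSite 3 M) 2) *ᵥ ψ) ⬝ᵥ
        ((totalSpin 1 0 - I • totalSpin 1 1 : Op (TorusSite 3 M) 2) *ᵥ ψ)).re = cohSum ψ N := by
  have hcard := InsertionFieldDelocalisation.Negative.card_torusSite 3 M
  have hsupp : ∀ S : Finset (TorusSite 3 M), S.card ≠ N → ψ (occInd S) = 0 := fun S hS =>
    LatticeCoherence.apply_ind_eq_zero_of_card_ne N (by rw [hcard]; push_cast; ring) hψ S hS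
  rw [EigenvalueContinuation.re_star_dotProduct_self, LatticeCoherence.sum_config_eq_sum_finset,
    Finset.sum_congr rfl fun T _ => by rw [lower_mulVec_occInd ψ T]]
  unfold cohSum
  symm
  refine Finset.sum_subset (Finset.subset_univ _) fun T _ hT => ?_
  have hcardT : T.card ≠ N - 1 := by simpa [Finset.mem_powersetCard] using hT
  have hzero : ∑ x ∈ Finset.univ \ T, ψ (occInd (insert x T)) = 0 := by
    refine Finset.sum_eq_zero fun x hx => ?_
    have hxT : x ∉ T := (Finset.mem_sdiff.mp hx).2
    exact hsupp _ (by rw [Finset.card_insert_of_notMem hxT]; omega)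
  rw [hzero, norm_zero, zero_pow two_ne_zero]

end Readout

/-- **S3 — lattice readout.** Given sector Perron–Frobenius (`SectorGroundStatePerron`) and the penalty
encoding (`PenaltySelectsSector`), for `M ≥ 2` and `1 ≤ N ≤ M³` the normalised Perron vector `ψ₁` of the
sector `S³_tot = N - M³/2` of `xyTorus 3 M 1` is a normalised sector ground vector with
`latticeBracket M N ≤ cohSum ψ₁ N` (indeed `=`): the penalised ground space is `ℂψ₁`, so the tracial
functional is `⟨ψ₁, · ψ₁⟩`; `(Sˣ)² + (Sʸ)² = S⁺S⁻ - Sᶻ` with `Sᶻ_tot = N - M³/2` on the sector; and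
`‖S⁻_tot ψ₁‖² = cohSum ψ₁ N`. [folklore] -/
theorem stub_latticeReadout : Sig.stub_latticeReadout := by
  intro hP hPen M _ hM N _hN1 hNM
  obtain ⟨ψ, hψ0, -, hψsec, hHψ, -, hgs⟩ :=
    LatticeCoherence.groundState_penalised hP hPen 3 M N (by norm_num) hM hNM
  obtain ⟨c, hc, -, hc1⟩ := EigenvalueContinuation.exists_normalize hψ0
  have hsec₁ : (c : ℂ) • ψ ∈ spinZSector 1 ((N : ℝ) - (M : ℝ) ^ 3 / 2) :=
    Submodule.smul_mem _ _ hψsec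
  refine ⟨(c : ℂ) • ψ, ⟨hsec₁, ?_, ?_⟩, ?_⟩
  · rw [mulVec_smul, hHψ, smul_comm]
  · rw [← EigenvalueContinuation.re_star_dotProduct_self, hc1, Complex.one_re]
  -- the tracial ground-state functional is the vector state of the normalised vector `c • ψ`
  have hk : ((c * c : ℝ) : ℂ) ≠ 0 := Complex.ofReal_ne_zero.mpr (mul_pos hc hc).ne'
  have hB₁ : ((c * c : ℝ) : ℂ) * (star ψ ⬝ᵥ ψ) = 1 := by
    rw [← EigenvalueContinuation.star_real_smul_dotProduct_real_smul]
    exact hc1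
  have hquot : ∀ O : Op (TorusSite 3 M) 2,
      star ψ ⬝ᵥ O *ᵥ ψ / star ψ ⬝ᵥ ψ = star ((c : ℂ) • ψ) ⬝ᵥ O *ᵥ ((c : ℂ) • ψ) := by
    intro O
    rw [← mul_div_mul_left (star ψ ⬝ᵥ O *ᵥ ψ) (star ψ ⬝ᵥ ψ) hk, hB₁, div_one, mulVec_smul,
      EigenvalueContinuation.star_real_smul_dotProduct_real_smul]
  -- `⟨(Ŝˣ)²+(Ŝʸ)²⟩ + (N - M³/2) = ‖Ŝ⁻ (c • ψ)‖² = cohSum (c • ψ) N`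
  have hplanar := LatticeCoherence.re_inner_planar_add ((N : ℝ) - (M : ℝ) ^ 3 / 2) _ hsec₁
  rw [hc1, Complex.one_re, mul_one, Readout.re_norm_lower_eq_cohSum N _ hsec₁] at hplanar
  unfold latticeBracket
  rw [hgs, hquot]
  linarith

end Summit.AtomisticToContinuum.BoseEinsteinCondensation.Cruxes.LatticeToPeriodicBridge.MuffinTinRewardSupermodularity

end
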